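import Summits.AtomisticToContinuum.Crystallization.Theorems.OverbindingBudgetAffineFarFieldCollarNear
import Summits.AtomisticToContinuum.Crystallization.Theorems.OverbindingBudgetAffineFarFieldCollarFacets
import Summits.AtomisticToContinuum.Crystallization.Theorems.OverbindingBudgetAffineFarFieldCellVoronoiFeed

/-!
# Overbinding budget, affine far field — «LedgerRows»: the ledger's mover hypotheses from per-site ROWS

Support file for `Summit.AtomisticToContinuum.Crystallization.Theses.OverbindingBudget.RobustDefectLimitWindows`
(sub-problem (2c), leaf SW♭(30), part 27V «Voronoi-cell quadrature of the far field», DENSITY rows, instance 27Vc).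
The far-field ledger «CellLedgerIdeal» ★ `farField_ledger_ideal` asks, per actual mover `i`, for ONE chart
`A i : E3 ≃L[ℝ] E3` from the CANONICAL ideal frame to the world with `‖A i − R i‖ ≤ ε` (`R i` a linear isometry),
`‖A i‖ ≤ a`, and the SANDWICH
`affMap 0 (y i) (A i) '' idealCell (ℓ i) (ν(1−s)) ⊆ K i ⊆ affMap 0 (y i) (A i) '' idealCell (ℓ i) (ν(1+s))` of its cell, and,
per reference site `j`, the reference cell as a moved ideal cell `moveMap 0 (q j) (Rr j) '' idealCell (ℓr j) ν`.
For the placed close-packed reference `placedSite s ν q R` («CollarSites») the frame of a site — the tangent-arrangement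
isometry of «CellLattice» `voronoiCell_placed_barlowStacking` — is EXISTENTIAL, so no atlas can name `A i`, `R i`, `Rr j`.
As in «CollarNear» (interface row) this file states the rows a K-file holds in WORLD coordinates and produces the charts
INSIDE the proof; since `A i`, `R i`, `Rr j` occur only in hypotheses of the ledger, an existential export suffices:

* (R-chart) `A : E3 ≃L[ℝ] E3`, `‖A x − x‖ ≤ θ‖x‖`; (R-conf) `|⟪A x, A x'⟫ − λ²⟪x, x'⟫| ≤ m·λ²‖x‖‖x'‖`, `m ≤ 1`;
  (R-norm) `‖A‖ ≤ a`;
* (R-star) every reference neighbour `u'` (`barlowSiteForm s u u' = 12`) is charted and its atom sits within `δ₀` of the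
  prediction `ych u + A (placedSite u' − placedSite u)`;
* (R-excl) the EXCLUSION ROW («CellVoronoi» `hZ`, applied to the OTHER atoms `Z ∖ {y}` — `voronoiCell_diff_singleton`):
  every atom `z ≠ ych u` of the window is either within `δ₀` of one of the twelve predictions or at distance
  `≥ 2a(1−σ)r₀ = √2·a(1−σ)ν` from `ych u` (second shell fitted by the same chart at `δ₂`:
  `‖A w‖ ≥ λ√(1−m)·√2ν` ⇒ needs `δ₂ ≤ √2λν·(√(1−m) − (1+ε)(1−σ))` = 5.1e-4·λν at ε 1e-3, σ 2.36e-3 (4.2e-3·λν at σ 5e-3);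
  rings from √(8/3)ν on by `û`-registration, `û ≤ 0.11ν`; uncharted core atoms by the margin `√2·a(1−σ)ν + 2û ≤ m`);
* (R-in) `(1−σ)·m·λ²ν²/2 + a·δ₀·((1−σ)r₀ + ν) ≤ σ(1−m)·λ²ν²/2` and
  (R-out) `(1+σ)·m·λ²ν²/2 + a·δ₀·((1+σ)r₀ + ν) + δ₀²/2 < σ(1−m)·λ²ν²/2`
  (`r₀ = ν/√2`; desk σ_min = 2.3525e-3 at m 2.001e-3, a 1.001, δ₀ 1e-4ν, λ 1 — book σ := 2.36e-3).

§1 `sandwich_of_star`: the two-sided «CellVoronoi» certificate for a chart given in world coordinates against a unit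
pattern `P` in a frame `G` (pattern-frame chart `G ≫ A`).  §2 ★ `ledgerRows_of_star`: for a placed site `u`, SOME chart
`A' = A ∘ G` and frame `G` with `‖A' − G‖ ≤ θ`, `‖A'‖ ≤ a`, `refCell u = moveMap 0 (placedSite u) G '' idealCell b ν` and
the sandwich of `voronoiCell (windowAtomSet …) (ych u)` between the `A'`-images of `idealCell b (ν(1∓σ))`, `b` the letter of the
layer of `u` — exactly the binders `hε / ha / hIK / hKO` of `farField_ledger_ideal` and its reference-cell shape.  §3: the
feed corollaries («CellVoronoiFeed») in row form — `moverCell_of_sandwich` (`hK / hKs / hvol`), `refCell_eq_moveMap` (every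
reference cell is a moved ideal cell), `aedisjoint_cell_of_reg` (`hd` from `û`-registration with `2û < ν`).

[this file; Conway–Sloane, Sphere Packings ch. 2, 21]
-/

namespace Summit.AtomisticToContinuum.Crystallization.Theorems.OverbindingBudgetAffineFarFieldLedgerRows

noncomputable section

open Set MeasureTheory Metric
open scoped Pointwise
open Literature.Geometry.DiscreteGeometry Literature.MathematicalPhysics.StatisticalMechanics
open Literature.Barriers.AtomisticToContinuum (voronoiCell)
open Summit.AtomisticToContinuum.Crystallization.Theorems.OverbindingBudgetAffineFarFieldCellAffine
open Summit.AtomisticToContinuum.Crystallization.Theorems.OverbindingBudgetAffineFarFieldCellMove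
open Summit.AtomisticToContinuum.Crystallization.Theorems.OverbindingBudgetAffineFarFieldCellRD
open Summit.AtomisticToContinuum.Crystallization.Theorems.OverbindingBudgetAffineFarFieldCellVoronoi
open Summit.AtomisticToContinuum.Crystallization.Theorems.OverbindingBudgetAffineFarFieldCellVoronoiFeed
open Summit.AtomisticToContinuum.Crystallization.Theorems.OverbindingBudgetAffineFarFieldCellLedgerIdeal
open Summit.AtomisticToContinuum.Crystallization.Theorems.OverbindingBudgetAffineFarFieldCellShell
open Summit.AtomisticToContinuum.Crystallization.Theorems.OverbindingBudgetAffineFarFieldCellLattice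
open Summit.AtomisticToContinuum.Crystallization.Theorems.OverbindingBudgetAffineFarFieldCollarSites
open Summit.AtomisticToContinuum.Crystallization.Theorems.OverbindingBudgetAffineFarFieldCollarWindow
open Summit.AtomisticToContinuum.Crystallization.Theorems.OverbindingBudgetAffineFarFieldCollarFacets
open Summit.AtomisticToContinuum.Crystallization.Theorems.OverbindingBudgetAffineFarFieldCollarNear

local notation "E3" => EuclideanSpace ℝ (Fin 3)
local notation "Idx" => ℤ × ℤ × ℤ

/-! ## §1 The two-sided sandwich from the star fit and the exclusion row, chart in world coordinates -/

/-- support: removing the centre from the atom set does not change its Voronoi cell (the centre's own constraint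
`dist p y ≤ dist p y` is void) — so «CellVoronoi»'s exclusion hypothesis is only ever asked of the OTHER atoms. [this file] -/
theorem voronoiCell_diff_singleton (Z : Set E3) (y : E3) : voronoiCell (Z \ {y}) y = voronoiCell Z y := by
  ext p
  simp only [voronoiCell, mem_setOf_eq, mem_sdiff, mem_singleton_iff]
  refine ⟨fun h w hw => ?_, fun h w hw => h w hw.1⟩
  by_cases hwy : w = y
  · rw [hwy]
  · exact h w ⟨hw, hwy⟩

/-- support (SANDWICH FROM THE STAR FIT, both sides): `P` a unit pattern whose shell cell at scale `ν` has circumradius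
`r` (`r² ≤ ν²/2`), `G` a linear isometry (reference frame: pattern → world), `A : E3 ≃L[ℝ] E3` the world chart (conformal
up to `m ≤ 1` at dilation `λ`, `‖A‖ ≤ a`), `0 ≤ σ < 1`.  If every star point `y + A(ν·G p)` has an atom of `Z` within `δ₀`,
every atom `z ≠ y` of `Z` is within `δ₀` of a star point or at distance `≥ 2a(1−σ)r` from `y`, and the two «CellVoronoi»
inequalities hold at slack `σ`, then the Voronoi cell of `y` is sandwiched between the images of the shell cells at
scales `1 ∓ σ` under the pattern-frame chart `G ≫ A`. [this file: «CellVoronoi» both inclusions] -/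
theorem sandwich_of_star {P : Finset E3} (hP : ∀ x ∈ P, ‖x‖ = 1) [Nonempty ↥P] {ν r : ℝ}
    (hν : 0 < ν) (hr : r ^ 2 ≤ ν ^ 2 / 2) (hPc : shellCell (patternStar P ν) 1 ⊆ closedBall 0 r) (G : E3 ≃ₗᵢ[ℝ] E3)
    (A : E3 ≃L[ℝ] E3) {y : E3} {Z : Set E3} {lam m a δ₀ σ : ℝ} (hm0 : 0 ≤ m) (hm1 : m ≤ 1)
    (hB : ∀ x x' : E3, |inner ℝ (A x) (A x') - lam ^ 2 * inner ℝ x x'| ≤ m * lam ^ 2 * ‖x‖ * ‖x'‖)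
    (ha : ‖(A : E3 →L[ℝ] E3)‖ ≤ a) (hσ0 : 0 ≤ σ) (hσ1 : σ < 1)
    (hstar : ∀ p ∈ P, ∃ z ∈ Z, ‖z - (y + A (ν • G p))‖ ≤ δ₀)
    (hexcl : ∀ z ∈ Z, z ≠ y → (∃ p ∈ P, ‖z - (y + A (ν • G p))‖ ≤ δ₀) ∨ 2 * a * (1 - σ) * r ≤ ‖z - y‖)
    (hin : (1 - σ) * m * lam ^ 2 * ν ^ 2 / 2 + a * δ₀ * ((1 - σ) * r + ν) ≤ σ * (1 - m) * lam ^ 2 * ν ^ 2 / 2)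
    (hout : (1 + σ) * m * lam ^ 2 * ν ^ 2 / 2 + a * δ₀ * ((1 + σ) * r + ν) + δ₀ ^ 2 / 2 <
      σ * (1 - m) * lam ^ 2 * ν ^ 2 / 2) :
    affMap 0 y (G.toContinuousLinearEquiv.trans A) '' shellCell (patternStar P ν) (1 - σ) ⊆ voronoiCell Z y ∧
      voronoiCell Z y ⊆ affMap 0 y (G.toContinuousLinearEquiv.trans A) '' shellCell (patternStar P ν) (1 + σ) := by
  set A' : E3 ≃L[ℝ] E3 := G.toContinuousLinearEquiv.trans A with hA'def
  have hA' : ∀ k, A' k = A (G k) := fun k => rfl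
  -- the rows in the pattern frame
  have hB' : ∀ x x' : E3, |inner ℝ (A' x) (A' x') - lam ^ 2 * inner ℝ x x'| ≤ m * lam ^ 2 * ‖x‖ * ‖x'‖ := by
    intro x x'
    have h := hB (G x) (G x')
    rwa [G.inner_map_map, G.norm_map, G.norm_map] at h
  have ha0 : 0 ≤ a := (norm_nonneg _).trans ha
  have ha' : ‖(A' : E3 →L[ℝ] E3)‖ ≤ a := by
    refine ContinuousLinearMap.opNorm_le_bound _ ha0 fun x => ?_
    have h1 : ‖A (G x)‖ ≤ ‖(A : E3 →L[ℝ] E3)‖ * ‖G x‖ := (A : E3 →L[ℝ] E3).le_opNorm (G x)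
    have h2 : ‖(A : E3 →L[ℝ] E3)‖ * ‖G x‖ ≤ a * ‖x‖ := by
      rw [G.norm_map]
      exact mul_le_mul_of_nonneg_right ha (norm_nonneg _)
    exact h1.trans h2
  have hV : ∀ i : ↥P, ‖patternStar P ν i‖ = ν := norm_patternStar hP hν.le
  have hnear : ∀ i : ↥P, ∃ z ∈ Z, ‖z - (y + A' (patternStar P ν i))‖ ≤ δ₀ := by
    intro i
    obtain ⟨z, hz, hd⟩ := hstar i i.2
    refine ⟨z, hz, ?_⟩
    rwa [patternStar_apply, hA', LinearIsometryEquiv.map_smul]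
  have hZ : ∀ z ∈ Z \ {y}, (∃ i : ↥P, ‖z - (y + A' (patternStar P ν i))‖ ≤ δ₀) ∨ 2 * a * (1 - σ) * r ≤ ‖z - y‖ := by
    intro z hz
    rcases hexcl z hz.1 (fun h => hz.2 (mem_singleton_iff.2 h)) with ⟨p, hp, hd⟩ | h
    · refine Or.inl ⟨⟨p, hp⟩, ?_⟩
      rwa [patternStar_apply, hA', LinearIsometryEquiv.map_smul]
    · exact Or.inr h
  have hIn := image_shellCell_subset_voronoiCell hν hV hr hPc hm0 hm1 hB' ha' hσ0 hσ1 hZ hin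
  rw [voronoiCell_diff_singleton] at hIn
  exact ⟨hIn, voronoiCell_subset_image_shellCell hν hV hr hPc hm0 hB' ha' hσ0 hnear hout⟩

/-! ## §2 The ledger's mover hypotheses for a placed site, from the rows -/

/-- ★ support (THE MOVER ROWS OF THE LEDGER FROM THE STAR): reference = placed close-packed sites (`s` Hägg, `0 < ν`, rigid
motion `(q, R)`), `r₀ = ν/√2`, actual atoms `windowAtomSet Ach ych yunc`, `b` the letter of the layer of `u`.  From a world
chart `A` (`‖A x − x‖ ≤ θ‖x‖`, conformal up to `m ≤ 1` at dilation `λ`, `‖A‖ ≤ a`), the star fit at `δ₀`, the exclusion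
row at `2a(1−σ)r₀` for the atoms `z ≠ ych u` and the two inequalities at slack `0 ≤ σ < 1`, there are a chart `A'` (`= A ∘ G`)
and a frame `G` with
`‖A' − G‖ ≤ θ`, `‖A'‖ ≤ a`, `refCell u = moveMap 0 (placedSite u) G '' idealCell b ν`, and
`affMap 0 (ych u) A' '' idealCell b (ν(1−σ)) ⊆ voronoiCell (windowAtomSet …) (ych u)` and
`voronoiCell (windowAtomSet …) (ych u) ⊆ affMap 0 (ych u) A' '' idealCell b (ν(1+σ))` — the binders `hε`, `ha`, `hIK`,
`hKO` of «CellLedgerIdeal» `farField_ledger_ideal` and its reference-cell shape.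
[this file: «CollarFacets» placement + §1 + «CellShell» `shellCell_pattern`] -/
theorem ledgerRows_of_star {μ : Type*} {s : ℤ → ℤ} (hs : IsHaggSeq s) {ν : ℝ} (hν : 0 < ν) (q : E3) (R : E3 ≃ₗᵢ[ℝ] E3)
    (Ach : Set Idx) (ych : Idx → E3) (yunc : μ → E3) {r₀ : ℝ} (hr₀ : r₀ = ν / Real.sqrt 2) (u : Idx) (A : E3 ≃L[ℝ] E3)
    {θ lam m a δ₀ σ : ℝ} (hθ0 : 0 ≤ θ) (hm0 : 0 ≤ m) (hm1 : m ≤ 1) (hσ0 : 0 ≤ σ) (hσ1 : σ < 1)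
    (hθ : ∀ x, ‖A x - x‖ ≤ θ * ‖x‖)
    (hB : ∀ x x' : E3, |inner ℝ (A x) (A x') - lam ^ 2 * inner ℝ x x'| ≤ m * lam ^ 2 * ‖x‖ * ‖x'‖)
    (ha : ‖(A : E3 →L[ℝ] E3)‖ ≤ a)
    (hstar : ∀ u', barlowSiteForm s u u' = 12 →
      u' ∈ Ach ∧ dist (ych u') (ych u + A (placedSite s ν q R u' - placedSite s ν q R u)) ≤ δ₀)
    (hexcl : ∀ z ∈ windowAtomSet Ach ych yunc, z ≠ ych u →
      (∃ u', barlowSiteForm s u u' = 12 ∧ dist z (ych u + A (placedSite s ν q R u' - placedSite s ν q R u)) ≤ δ₀) ∨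
        2 * a * (1 - σ) * r₀ ≤ dist z (ych u))
    (hin : (1 - σ) * m * lam ^ 2 * ν ^ 2 / 2 + a * δ₀ * ((1 - σ) * r₀ + ν) ≤ σ * (1 - m) * lam ^ 2 * ν ^ 2 / 2)
    (hout : (1 + σ) * m * lam ^ 2 * ν ^ 2 / 2 + a * δ₀ * ((1 + σ) * r₀ + ν) + δ₀ ^ 2 / 2 <
      σ * (1 - m) * lam ^ 2 * ν ^ 2 / 2) :
    ∃ (A' : E3 ≃L[ℝ] E3) (G : E3 ≃ₗᵢ[ℝ] E3), (∀ k, A' k = A (G k)) ∧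
      ‖(A' : E3 →L[ℝ] E3) - G.toLinearIsometry.toContinuousLinearMap‖ ≤ θ ∧ ‖(A' : E3 →L[ℝ] E3)‖ ≤ a ∧
      refCell s ν q R u = moveMap 0 (placedSite s ν q R u) G '' idealCell (decide (s (u.1 - 1) = s u.1)) ν ∧
      affMap 0 (ych u) A' '' idealCell (decide (s (u.1 - 1) = s u.1)) (ν * (1 - σ)) ⊆
          voronoiCell (windowAtomSet Ach ych yunc) (ych u) ∧
        voronoiCell (windowAtomSet Ach ych yunc) (ych u) ⊆
          affMap 0 (ych u) A' '' idealCell (decide (s (u.1 - 1) = s u.1)) (ν * (1 + σ)) := by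
  obtain ⟨A₀, hK, hV⟩ := exists_barlowPlacement (q := q) (R := R) hs hν u
  haveI : Nonempty ↥(bif decide (s (u.1 - 1) = s u.1) then fccKissingPattern else hcpKissingPattern) := nonempty_letterPattern _
  have hP : ∀ x ∈ (bif decide (s (u.1 - 1) = s u.1) then fccKissingPattern else hcpKissingPattern), ‖x‖ = 1 :=
    norm_eq_one_of_mem_letterPattern _
  -- the reference frame of the site and the chart in the canonical ideal frame
  set G : E3 ≃ₗᵢ[ℝ] E3 := A₀.trans R with hGdef
  have hG : ∀ k, G k = R (A₀ k) := fun k => rfl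
  set A' : E3 ≃L[ℝ] E3 := G.toContinuousLinearEquiv.trans A with hA'def
  have hA' : ∀ k, A' k = A (G k) := fun k => rfl
  -- bonds are star points and star points are bonds
  have hbond : ∀ u', barlowSiteForm s u u' = 12 →
      ∃ p ∈ (bif decide (s (u.1 - 1) = s u.1) then fccKissingPattern else hcpKissingPattern),
        placedSite s ν q R u' - placedSite s ν q R u = ν • G p := by
    intro u' h12
    obtain ⟨p, hp, e⟩ := exists_pattern_of_form_eq_twelve h12 hK
    refine ⟨p, hp, ?_⟩
    rw [placedSite_apply, placedSite_apply, add_sub_add_left_eq_sub, ← smul_sub, ← map_sub, e, map_smul, smul_smul,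
      show ν / 2 * 2 = ν by ring, hG]
  have hpat : ∀ p ∈ (bif decide (s (u.1 - 1) = s u.1) then fccKissingPattern else hcpKissingPattern),
      ∃ u', barlowSiteForm s u u' = 12 ∧ placedSite s ν q R u' - placedSite s ν q R u = ν • G p := by
    intro p hp
    have hpK : (2 : ℝ) • A₀ p ∈
        kissingShell (barlowStacking 2 layerSpacing s) (barlowPos 2 layerSpacing s u.1 u.2.1 u.2.2) := by
      rw [hK]
      exact ⟨p, hp, rfl⟩
    obtain ⟨k, i, j, hkij⟩ := mem_barlowStacking_iff.1 hpK.1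
    have e : placedSite s ν q R (k, i, j) = q + (ν / 2) • R (barlowPos 2 layerSpacing s k i j) := rfl
    have hsite : placedSite s ν q R (k, i, j) - placedSite s ν q R u = ν • G p := by
      rw [e, ← hkij, placedSite_apply, map_add, smul_add, LinearIsometryEquiv.map_smul, smul_smul,
        show ν / 2 * 2 = ν by ring, hG]
      abel
    have hd : dist (placedSite s ν q R u) (placedSite s ν q R (k, i, j)) = ν := by
      rw [dist_comm, dist_eq_norm, hsite, norm_smul, Real.norm_of_nonneg hν.le, G.norm_map, hP p hp, mul_one]
    exact ⟨(k, i, j), (dist_placedSite_eq_iff hν u (k, i, j)).1 hd, hsite⟩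
  -- the rows in the form §1 wants
  have hstar' : ∀ p ∈ (bif decide (s (u.1 - 1) = s u.1) then fccKissingPattern else hcpKissingPattern),
      ∃ z ∈ windowAtomSet Ach ych yunc, ‖z - (ych u + A (ν • G p))‖ ≤ δ₀ := by
    intro p hp
    obtain ⟨u', h12, e⟩ := hpat p hp
    obtain ⟨hA, hδ⟩ := hstar u' h12
    refine ⟨ych u', Or.inl ⟨u', hA, rfl⟩, ?_⟩
    rwa [dist_eq_norm, e] at hδ
  have hexcl' : ∀ z ∈ windowAtomSet Ach ych yunc, z ≠ ych u →
      (∃ p ∈ (bif decide (s (u.1 - 1) = s u.1) then fccKissingPattern else hcpKissingPattern),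
        ‖z - (ych u + A (ν • G p))‖ ≤ δ₀) ∨ 2 * a * (1 - σ) * r₀ ≤ ‖z - ych u‖ := by
    intro z hz hne
    rcases hexcl z hz hne with ⟨u', h12, hd⟩ | h
    · obtain ⟨p, hp, e⟩ := hbond u' h12
      refine Or.inl ⟨p, hp, ?_⟩
      rwa [dist_eq_norm, e] at hd
    · right
      rwa [dist_eq_norm] at h
  -- §1 at circumradius r₀, shell cells = ideal cells
  have hr : r₀ ^ 2 ≤ ν ^ 2 / 2 := by
    rw [hr₀]
    exact circumradius_sq ν
  have hPc : shellCell (patternStar (bif decide (s (u.1 - 1) = s u.1) then fccKissingPattern else hcpKissingPattern) ν) 1 ⊆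
      closedBall 0 r₀ := by
    rw [shellCell_pattern hν 1, one_mul, hr₀]
    exact idealCell_subset_closedBall _ hν.le
  obtain ⟨hIn, hOut⟩ := sandwich_of_star hP hν hr hPc G A hm0 hm1 hB ha hσ0 hσ1 hstar' hexcl' hin hout
  rw [shellCell_pattern hν (1 - σ), mul_comm (1 - σ) ν] at hIn
  rw [shellCell_pattern hν (1 + σ), mul_comm (1 + σ) ν] at hOut
  refine ⟨A', G, hA', ?_, ?_, ?_, hIn, hOut⟩
  · -- `‖A' − G‖ ≤ θ`
    refine ContinuousLinearMap.opNorm_le_bound _ hθ0 fun x => ?_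
    have h := hθ (G x)
    rw [G.norm_map] at h
    have e1 : ((A' : E3 →L[ℝ] E3) - G.toLinearIsometry.toContinuousLinearMap) x = A (G x) - G x := rfl
    rw [e1]
    exact h
  · -- `‖A'‖ ≤ a`
    have ha0 : 0 ≤ a := (norm_nonneg _).trans ha
    refine ContinuousLinearMap.opNorm_le_bound _ ha0 fun x => ?_
    have h1 : ‖A (G x)‖ ≤ ‖(A : E3 →L[ℝ] E3)‖ * ‖G x‖ := (A : E3 →L[ℝ] E3).le_opNorm (G x)
    have h2 : ‖(A : E3 →L[ℝ] E3)‖ * ‖G x‖ ≤ a * ‖x‖ := by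
      rw [G.norm_map]
      exact mul_le_mul_of_nonneg_right ha (norm_nonneg _)
    exact h1.trans h2
  · -- the reference cell is the moved ideal cell
    have e : moveMap 0 (placedSite s ν q R u) G = fun y => placedSite s ν q R u + R (A₀ y) := by
      funext y
      simp only [moveMap, sub_zero, hG]
    show voronoiCell (range (placedSite s ν q R)) (placedSite s ν q R u) = _
    rw [e]
    exact hV

/-! ## §3 The feed corollaries in row form -/

/-- support: a sandwiched Voronoi cell is compact, star-convex about its atom and has positive volume — the binders
`hK`, `hKs`, `hvol` of the ledger (leaf hypothesis `hC` for the volume of the ideal cell). [«CellVoronoiFeed» + «CellLedgerIdeal»] -/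
theorem moverCell_of_sandwich (hC : HasRadialMoments (rdCell 1) 16 24 (656 / 15)) (b : Bool) {ν σ : ℝ} (hν : 0 < ν)
    (hσ1 : σ < 1) {Z : Set E3} {y : E3} (A' : E3 ≃L[ℝ] E3)
    (hIn : affMap 0 y A' '' idealCell b (ν * (1 - σ)) ⊆ voronoiCell Z y)
    (hOut : voronoiCell Z y ⊆ affMap 0 y A' '' idealCell b (ν * (1 + σ))) (hσ0 : 0 ≤ σ) :
    IsCompact (voronoiCell Z y) ∧ StarConvex ℝ y (voronoiCell Z y) ∧ 0 < (volume (voronoiCell Z y)).toReal := by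
  have hνp : 0 ≤ ν * (1 + σ) := by positivity
  have hνm : 0 < ν * (1 - σ) := mul_pos hν (by linarith)
  have hc : IsCompact (voronoiCell Z y) := isCompact_voronoiCell_of_subset (isCompact_idealCell b hνp) hOut
  refine ⟨hc, starConvex_voronoiCell Z y, ?_⟩
  refine volume_voronoiCell_pos hc (isCompact_idealCell b hνm.le).measurableSet ?_ hIn
  rw [volume_idealCell hC b hνm]
  positivity

/-- support: EVERY reference cell is a moved ideal cell of the letter of its layer (the ledger's reference-cell shape
`moveMap 0 (q j) (Rr j) '' idealCell (ℓr j) ν`, frame existential). [«CollarFacets» placement] -/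
theorem refCell_eq_moveMap {s : ℤ → ℤ} (hs : IsHaggSeq s) {ν : ℝ} (hν : 0 < ν) (q : E3) (R : E3 ≃ₗᵢ[ℝ] E3) (u : Idx) :
    ∃ G : E3 ≃ₗᵢ[ℝ] E3,
      refCell s ν q R u = moveMap 0 (placedSite s ν q R u) G '' idealCell (decide (s (u.1 - 1) = s u.1)) ν := by
  obtain ⟨A₀, -, hV⟩ := exists_barlowPlacement (q := q) (R := R) hs hν u
  refine ⟨A₀.trans R, ?_⟩
  have e : moveMap 0 (placedSite s ν q R u) (A₀.trans R) = fun y => placedSite s ν q R u + R (A₀ y) := by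
    funext y
    simp only [moveMap, sub_zero]
    rfl
  show voronoiCell (range (placedSite s ν q R)) (placedSite s ν q R u) = _
  rw [e]
  exact hV

/-- support: distinct `û`-registered charted atoms are distinct points when `2û < ν` (sites are `ν`-separated), so
their Voronoi cells in the window are a.e.-disjoint — the binder `hd` of the ledger. [«CollarSites» + «CellVoronoiFeed»] -/
theorem aedisjoint_cell_of_reg {μ : Type*} {s : ℤ → ℤ} (hs : IsHaggSeq s) {ν : ℝ} (hν : 0 < ν) (q : E3)
    (R : E3 ≃ₗᵢ[ℝ] E3) (Ach : Set Idx) (ych : Idx → E3) (yunc : μ → E3) {û : ℝ} (hû : 2 * û < ν)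
    (hreg : ∀ u ∈ Ach, dist (ych u) (placedSite s ν q R u) ≤ û) {u u' : Idx} (hu : u ∈ Ach) (hu' : u' ∈ Ach)
    (hne : u ≠ u') :
    AEDisjoint volume (voronoiCell (windowAtomSet Ach ych yunc) (ych u)) (voronoiCell (windowAtomSet Ach ych yunc) (ych u')) := by
  refine aedisjoint_voronoiCell (Or.inl ⟨u, hu, rfl⟩) (Or.inl ⟨u', hu', rfl⟩) fun h => ?_
  have h1 := le_dist_placedSite (q := q) (R := R) hs hν hne
  have h2 : dist (placedSite s ν q R u) (placedSite s ν q R u') ≤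
      dist (placedSite s ν q R u) (ych u) + dist (ych u) (ych u') + dist (ych u') (placedSite s ν q R u') :=
    dist_triangle4 _ _ _ _
  have h3 : dist (placedSite s ν q R u) (ych u) ≤ û := by
    rw [dist_comm]
    exact hreg u hu
  have h4 : dist (ych u) (ych u') = 0 := by rw [h, dist_self]
  linarith [hreg u' hu']

end

end Summit.AtomisticToContinuum.Crystallization.Theorems.OverbindingBudgetAffineFarFieldLedgerRows
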